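import Literature.NumberTheory.EllipticCurves.YanZhu2026.GreenbergMainTheorems
import Literature.NumberTheory.EllipticCurves.BurungaleSkinnerTianWan2024.SupersingularTwistPPartOPEN
import HarnessLib

/-!
# Burungale–Skinner–Tian–Wan (arXiv:2409.01350v2, PREPRINT), §9.4.2 Thm. 9.24 (GMC_r): "the
# Greenberg `p`-adic `L`-function divides the characteristic ideal of the two-variable Greenberg Selmer
# group, away from the cyclotomic line" (N square-free, ANY prime `p ∤ 2N` — ordinary OR
# supersingular —, (ord), (irr_L), (spl)) + its quadratic-twist clause, for an elliptic curve —
# explicitly labelled OPEN binders (claim-tagged; NEVER facts) in the tree's two-variable Greenberg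
# currency (`XGr₂`, `IwasawaAlgebra₂.toUnr₂/ofPlus`, Katz frame `IsKatzMeasure₂`), with a
# reduction-type-free, continuation-bound variant of the Yan–Zhu / CGS value frame for `𝓛_p^Gr` (v2)

Written by the typer seat `bsd-littype-01` (gen 4) of the cross-ladder literature-typing layer
(D-0088(4); cell `run/shared/lean/pub/bsd-littype/`). D-0064: one file for §9.4.2 of the source
(§9.4.1 Thm. 9.21 = Kato / Skinner–Urban / Wan restated — tree facts `kato_divisibility`,
`skinner_urban_main_conj…` (bsd.S21), `burungale_castella_skinner_charIdeal_eq_padicLFunction`, its twist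
clauses descended in gen 2's `QuadraticTwistPPartOPEN.lean`; §9.4.1 Cor. 9.23 needs the hypothesis
(nv) on the two-variable zeta element — no tree carrier, NOT typed; §9.4.3 Thm. 9.26 = Howard / CGS25
Thm. 6.5.1, covered). HONEST FRAMING: UNREFEREED preprint ⇒ explicitly labelled OPEN hypotheses only
(`def … : Prop`, `[claim: …, status: under-review]`), NEVER theorems, NEVER `[cite:]`-facts; nothing
asserted about any curve; nothing booked; no `_holds`. ONE definition with body (the value frame
`IsGreenbergLFunctionAnyRoot₂`, see below), TWO OPEN binders, and bookkeeping theorems PROVED here.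

## Printed statement (arXiv:2409.01350v2, pp. 85–86 [litref page file p0085–p0086]; label `GMC_r`,
## tex l.7258–7273; proof l.7274–7287)

"**Theorem 9.24.** Let `g ∈ S₂(Γ₀(N))` be an elliptic newform with `N` square-free and `p ∤ 2N` a
prime. Let `L` be an imaginary quadratic field satisfying (2.15) and (irr_L). Write `N = N⁺N⁻` for `N⁺`
precisely divisible by split primes in `L`. Suppose that
(spl) There exists a prime `q ∣ N⁻`, and if `2` does not split in `L`, then `2 ∣ N⁻`.
Then we have a divisibility of ideals [display, label Gr-div] `𝓛_p^Gr(g_{/L}) ∣ ξ(X_Gr^ur(g_{/L}))` in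
`Λ_{L,𝒪_λ}^{ur} ⊗_{Λ_{L,𝒪_λ}^{cyc,ur}} Frac(Λ_{L,𝒪_λ}^{cyc,ur})`.
For `g` and `p` as above, let `K` be a quadratic extension of `ℚ` with discriminant prime to `Np`, and
`g_K := g ⊗ χ_K` the quadratic twist. Then the divisibility also holds for `g_K`."
Proof (p. 86): "This is essentially the content of [CLW, Thm. 8.2.3] (see also [W1]). In view of Theorem
5.1 [label excz] the proof of [CLW, Prop. 8.2.2] applies for the case `ξ = 𝟙_L` … `𝓛_{π,L,𝟙_L}` is nothing
but the Greenberg `p`-adic `L`-function `𝓛_p^Gr(g_{/L})` … The conductor of the quadratic twist `g_K` is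
not square-free. So this case is not explicitly covered by the results of [W1,CLW], but essentially the
same argument applies." Remark: "While the method of [CLW] uniformly treats the ordinary and
non-ordinary primes, the ordinary case goes back to [W1]." PROVENANCE FLAGS for the referee desks:
cell `bsd-ssimc` TARGET §3a grade of record "GAP(G2)" on exactly this proof step ([CLW Thm. 8.2.1]'s
residual-distinctness hypothesis excludes `ξ = 𝟙`; the modified lattice argument is unwritten in
refereed print), and OPEN-QUESTIONS-01 Q17 (the twist clause rests on "essentially the same argument
applies"). Labels: (2.15) = (ord) `p = v v̄` splits in `L`, `v` determined by `ι_p` (§1.2.1 (h2));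
(irr_L) (§2.2, tex l.1265) "`T̄` is an absolutely irreducible `k_λ[G_L]`-module"; `X_Gr(g/L)` the
Pontryagin dual of the two-variable Greenberg Selmer group (9.2, label GrL, l.6760: strict at the
`ι_p`-prime `v` and at `w ∤ p`, no condition at `v̄`), `X_Gr^ur = X_Gr ⊗ Λ^ur`; `𝓛_p^Gr(g/L) :=
𝓛_v̄(loc_v̄ 𝒵(g/L)) ∈ Λ_L^ur` (§5.4, l.4704; §1.2.1: "a bounded measure independent of the type of
reduction of `E` at `p`"), characterised by the Explicit Reciprocity Law II′ (Thm. 5.11, l.4278) on the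
type-II range `Ξ^(II)`.

## Transcription (E-instances `g = f_E`, `L = K`, `𝒪_λ = ℤ_p`), and what currency

* THE TWO-VARIABLE ALGEBRA AND THE SELMER SIDE are the tree's (`TwoVariableSelmerDual.lean`, p459343;
  `YanZhu2026/GreenbergMainTheorems.lean`, p479007): `(κ₁, κ₂)` THE cyclotomic / anticyclotomic
  `ℤ_p`-extensions of `K` with an adapted generator pair `(γ₁, γ₂)`, `Λ_L = IwasawaAlgebra₂ p`,
  `Λ_L^{cyc} = Λ⁺ = ofPlus(ℤ_p⟦T₁⟧)`, `X_Gr = (W.baseChange K).XGr₂ p κ₁ κ₂ v̄ γ₁ γ₂`, `char(X_Gr)Λ^ur`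
  read in `𝒪_{ℂ_p}⟦T₁⟧⟦T₂⟧` along a structure-compatible `J : ℤ_p → 𝒪_{ℂ_p}` (`toUnr₂ p J`, WEAKER than
  `Λ^ur`). The printed localisation `Λ^ur ⊗_{Λ^{cyc,ur}} Frac(Λ^{cyc,ur})` ("invert the non-zero elements
  of the cyclotomic algebra `Λ^{cyc,ur} = ℤ_p^ur⟦T₁⟧`") is written in one-element form (as Yan–Zhu Cor. 4.6
  / Thm. 4.7 are in the tree, (T8) of `GreenbergMainTheorems.lean`): there is a non-zero `s` in the
  cyclotomic-variable subring with `s · char(X_Gr)𝒪_{ℂ_p}⟦T₁,T₂⟧ ⊆ (G)`. The witness `s` is allowed in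
  `𝒪_{ℂ_p}⟦T₁⟧ ⊇ Λ^{cyc,ur}` (embedded as series constant in `T₂`, `PowerSeries.map C s` — the image of
  `ofPlus` for `s ∈ ℤ_p⟦T₁⟧`): WEAKER than print (the printed witness `t ∈ Λ^{cyc,ur} ∖ 0` is one), never
  stronger; NOT `s ∈ Λ^{cyc} = ℤ_p⟦T₁⟧`, which would be STRONGER than print (a factor `T₁ − a` of `𝓛_p^Gr`
  with `a ∈ pℤ_p^ur` transcendental over `ℚ_p` divides no non-zero element of `ℤ_p⟦T₁⟧`).
* THE `L`-FUNCTION SIDE: the tree's two Greenberg carriers of 2026-08-27 are ORDINARY-ONLY and one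
  is unsatisfiable as typed. (i) Yan–Zhu's VALUE frame `IsGreenbergLFunction₂` (p479007; Def. 3.11 =
  CGS25 Def. 2.4.3: `𝓛_p^Gr = h_K · 𝓛_𝔭(K)' · 𝓛_p^II`, values on the type-II range relative to a Katz frame
  `IsKatzMeasure₂ ι v v̄ ∅ …`) quantifies over the UNIT root `α` (`‖ι⁻¹α‖_p = 1`) of `x² − a_p x + p` — at
  a SUPERSINGULAR `p` there is none (both roots have valuation `½`), so that clause is VACUOUS there;
  CGS's `IsHidaRankinLFunctionII` (p477061) plugs in `ι(unitRoot W p)`, junk at a supersingular `p`.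
  Thm. 9.24 is stated for EVERY `p ∤ 2N` and `𝓛_p^Gr` "is independent of the type of reduction"; the
  printed type-II Euler factor `𝓔(ξ,f,1) = (1 − p⁻¹ξ(𝔭̄)α)(1 − ξ(𝔭̄)α⁻¹)(1 − p⁻¹ξ⁻¹(𝔭)α)(1 − ξ⁻¹(𝔭)α⁻¹)`
  is SYMMETRIC under `α ↦ p/α` (PROVED below: `typeTwoEulerFactor_div`), so the frame of THIS file asks
  the value at EVERY root (same content at ordinary `p`, meaningful at supersingular `p`; BSTW ERL II′,
  Thm. 5.11, prints the same symmetric factor `(1 − a(p)ψ(ϖ_v̄)⁻¹p⁻¹ + ψ(ϖ_v̄)⁻²p⁻¹)²`). (ii) Yan–Zhu's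
  frame reads `L(f/K, ξ, 1)` through `rankinSelbergValueHecke f ξ 1`, whose defining agreement is on the
  FIXED half-plane `re s > 3/2` — sound for unitary `ξ` only; for the non-unitary type-II characters
  (`|ξ(ϖ_w)| = Nw^{±(n−m)/2}`) the Euler product is junk on a band, the value is the junk `0` on a
  Zariski-dense half of the range and NO `G` satisfies the frame (located by the CGS typer littype-02,
  2026-08-27T01:24Z, with the tree lemma `rankinSelbergValueHecke_eq_zero_of_forall_not_agree`, p482867).
  The frame of THIS file therefore binds the `L`-value as CGS's `IsHidaRankinLFunctionII` does: through
  an INLINE entire continuation `L` of `rankinSelbergEulerProductHecke f ξ` from the generous half-plane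
  `re s > m + n + 3` (absolute convergence there under either sign convention for the type), value `L 1`.
  Everything else (Katz factor at the inverse generators, `h_K`, the archimedean constant, the CM newform
  `θ` of `ξ_b` and its Petersson norm, the denominator `(1 − ξ^{1−τ}(𝔭̄))(1 − p⁻¹ξ^{1−τ}(𝔭̄))`) is
  Yan–Zhu's, reused by name. v2 of this file (the v1 frame, landed as p483018, copied defect (ii); no
  consumer existed; corrected in place within the hour, comparison lemmas to the defective frame dropped).
* CONVENTION (READING FLAG `BSTW-924-conjugate-convention`): the source's `X_Gr` is strict at the
  `ι_p`-prime `v` with no condition at `v̄` and `𝓛_p^Gr` is read off at `v̄`; the tree currency (Yan–Zhu /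
  BCS / CGS) is relaxed at the `ι`-prime `v = 𝔭` and unramified at `v̄` (`XGr₂ … v̄`, flag
  `YZ-2VAR-Gr-str-is-unr`), with the Katz factor `𝓛_𝔭(K)`. The two conventions are exchanged by complex
  conjugation acting on `(L, v, Γ_L)`; since the binder quantifies over ALL embedding data `(ι, v, v̄)`,
  the typed family of statements is the conjugate image of the printed family (cell `bsd-ssimc`, audit-1
  addF / MEMO-8 "Theorem 8": `(L_p^Gr)_{CGS} = (c_*𝓛_p^Gr)_{BSTW}` in `Λ_K^ur`, cell-refereed, NOT in
  print — hence a FLAG, and the reason this binder is claim-tagged twice over).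
* (irr_L) ↦ every `𝔽_p`-framing of `E[p]|_{G_K}` is absolutely irreducible (Yan–Zhu's spelling in
  `thm42_XGr₂_…`); (ord) ↦ `#primesOver p = 2` with `v ≠ v̄` above `p`, `v` induced by `ι` (the `compat`
  clause of `YanZhu2026.GreenbergSetting`); `N` square-free ↦ `Squarefree N`, `N = N_E`; `p ∤ 2N` ↦
  `p ≠ 2`, `¬ p ∣ N`; (spl) ↦ (∃ prime `q ∣ N` NOT split in `K`) ∧ (`2` splits in `K` ∨ `2 ∣ N`); EXTRA
  (WEAKER) `(N, D_K) = 1` = the Introduction's standing (h1) under which `𝓛_p^Gr(E/L)` is introduced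
  (§1.2.1, l.645; "the main text allows `D_L` and `N` to have some common divisors").
* Twist clause ↦ `W'` a globally minimal model of `E^{(d)}`, `d ≠ 1` square-free with every prime
  ramified in `ℚ(√d)` different from `p` and prime to `N` (`RamifiedInQuadratic`, the spelling of the
  sibling twist binders), `f'` its newform at level `N' = N_{E^{(d)}}`; same conclusion for `(W', f')`.

WEAKER-OR-EQUAL to print in every binder except for the two READING FLAGS above; never knowingly
stronger. WHAT IS NOT HERE: Cor. 9.23 ((nv)); the `𝒪_λ ≠ ℤ_p` generality; existence of the frames at a
supersingular `p` (Yan–Zhu's `thm39_def311_…` supplies them at ordinary `p` only; BSTW Thm. 5.11 is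
PREPRINT); the equality / (b)-type refinements (none printed in 9.24).

CONSUMERS: cell `bsd-ssimc` (LADDER-BSD K3, "BSTW Thm. 1.3/1.5/§9.3.2 as ours"): Thm. 9.24 is THE
external lower-bound input of the printed proof of Kobayashi's main conj. (Thm. 10.1 ⟸ 9.24 + 9.18 +
10.4 + 10.7); this is its first tree node. Ideation: OPEN-QUESTIONS-01 §G.

## References
* [BurungaleSkinnerTianWan2024] arXiv:2409.01350v2: Thm. 9.24 (pp. 85–86; label GMC_r, tex
  l.7258–7287), (spl) (l.7263), statement 9.12 (label Greenberg, p. 81), 9.2 (GrL, l.6760), §5.4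
  (l.4683–4705), Thm. 5.11 (ERLIIint-thm, l.4278), §1.2.1 (h1)/(h2) (l.645–652), (irr_K) (l.1265).
* [YanZhu2024MainConjNonCM] J. Algebra 693 (2026), Thm. 3.9 / Def. 3.11 — the value frame (tree).
* [CastellaGrossiSkinner2025] Math. Ann. 393, Def. 2.4.3 / Thm. 2.4.1 — the same object (tree, p477061).
* [CastellaLiuWan2022] = [CLW], FMS; [Wan2020ANT] = [W1] — the printed sources of the proof.
-/

noncomputable section

open scoped Classical

open PowerSeries NumberField IsDedekindDomain Field CongruenceSubgroup Polynomial
  Literature.NumberTheory.GaloisRepresentations Literature.NumberTheory.EllipticCurves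
  Literature.NumberTheory.EllipticCurves.ModularForms Literature.NumberTheory.EllipticCurves.Rank1Residual

/-! ### The reduction-type-free value frame for `𝓛_p^Gr` (Yan–Zhu Def. 3.11 with any root `α`) -/

namespace Literature.NumberTheory.EllipticCurves

section TypeTwo

variable {K : Type} [Field K] [NumberField K] {N : ℕ} {p : ℕ}

/-- **The type-II Euler factor is symmetric under `α ↦ p/α`**: `𝓔(ξ,f,1)` computed with either root of
`x² − a_p x + p` is the same complex number (`(1 − p⁻¹ξ(𝔭̄)α)(1 − ξ(𝔭̄)α⁻¹) = (1 − ξ(𝔭̄)/β)(1 − ξ(𝔭̄)/α)`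
with `β = p/α`). Hence Yan–Zhu's unit-root clause only SELECTS a root and the value frame makes sense
at a supersingular `p` (BSTW Thm. 5.11: the factor `(1 − a(p)ψ(ϖ_v̄)⁻¹p⁻¹ + ψ(ϖ_v̄)⁻²p⁻¹)²`).
[cite: YanZhu2024MainConjNonCM, Thm. 3.9 (𝓔(ξ,f,1), arXiv:2412.20078v4 TeX l.846–848)]
[cite: BurungaleSkinnerTianWan2024, Thm. 5.11 (tex l.4278–4291), the factor 𝓔′(χ)] -/
theorem typeTwoEulerFactor_div (α : ℂ) (hα : α ≠ 0) (hp : (p : ℂ) ≠ 0) (ξ : HeckeCharacter K)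
    (v vbar : HeightOneSpectrum (𝓞 K)) :
    typeTwoEulerFactor p ((p : ℂ) / α) ξ v vbar = typeTwoEulerFactor p α ξ v vbar := by
  simp only [typeTwoEulerFactor]
  field_simp

/-- **The right-hand side of Yan–Zhu Thm. 3.9 / CGS Thm. 2.4.1 with the `L`-value as a PARAMETER**
`L1` (to be fed the value at `1` of an entire continuation of the Euler product, as in
`CastellaGrossiSkinner2025.hidaIIInterpolationValue`): `2^{a−b} i^{b−a−1} Γ(b+1)Γ(b) N^{a+b+1} /
((2π)^{2b+1}⟨θ,θ⟩) · 𝓔(ξ,f,1) / ((1 − ξ^{1−τ}(𝔭̄))(1 − p⁻¹ξ^{1−τ}(𝔭̄))) · L1` — Yan–Zhu's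
`typeTwoInterpolationValue` with `rankinSelbergValueHecke f ξ 1` (junk for non-unitary `ξ`) replaced by
`L1`; `Nlev` = the level `N` of `f` (Yan–Zhu; flag `YZ-39-petersson` / `CGS-241-level` of the sibling typers
for the level at which `⟨θ,θ⟩` and `N^{a+b+1}` are taken). [cite: YanZhu2024MainConjNonCM, Thm. 3.9 (arXiv:2412.20078v4 TeX l.839–849)]
[cite: CastellaGrossiSkinner2025, Thm. 2.4.1 (final TeX l.942–956)] -/
def typeTwoInterpolationValueL (p Nlev : ℕ) (v vbar : HeightOneSpectrum (𝓞 K))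
    (α : ℂ) (ξ : HeckeCharacter K) (a b : ℤ) (pet : ℝ) (L1 : ℂ) : ℂ :=
  typeTwoArchimedeanConstant Nlev a b pet * typeTwoEulerFactor p α ξ v vbar /
      typeTwoDenominator p ξ v vbar * L1

/-- The parametrised right-hand side is the same for `α` and `p/α`.
[cite: YanZhu2024MainConjNonCM, Thm. 3.9 (arXiv:2412.20078v4 TeX l.839–849)] -/
theorem typeTwoInterpolationValueL_div (Nlev : ℕ) (v vbar : HeightOneSpectrum (𝓞 K))
    (α : ℂ) (hα : α ≠ 0) (hp : (p : ℂ) ≠ 0) (ξ : HeckeCharacter K) (a b : ℤ) (pet : ℝ) (L1 : ℂ) :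
    typeTwoInterpolationValueL p Nlev v vbar ((p : ℂ) / α) ξ a b pet L1 =
      typeTwoInterpolationValueL p Nlev v vbar α ξ a b pet L1 := by
  simp only [typeTwoInterpolationValueL, typeTwoEulerFactor_div α hα hp]

variable [Fact p.Prime]

/-- **The value frame for `G = 𝓛_p^Gr(f/K) = h_K · 𝓛_𝔭(K)' · 𝓛_p^II(f/K)`, reduction-type-free and with
the `L`-value read through an entire continuation** — Yan–Zhu's `IsGreenbergLFunction₂` (same
parameters, same Katz series `LK` read at `(0, r(g₂)² − 1)`, same `h_K`, same CM newform `θ` of `ξ_b`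
and Petersson norm) with TWO changes (module docstring, "THE `L`-FUNCTION SIDE"): the value is demanded
at EVERY complex root `α` of `x² − a_p(f)x + p` (by `typeTwoEulerFactor_div` it does not depend on the
root; at a supersingular `p` there is no unit root), and `L(f/K, ξ, 1)` is `L 1` for every entire `L`
agreeing with `rankinSelbergEulerProductHecke f ξ` on `re s > m + n + 3` (absolute convergence; the
continuation — a Rankin–Selberg `L`-function of two cusp forms of different weights — is entire and
unique). The reading of BSTW's `𝓛_p^Gr(g/L)`, "a bounded measure independent of the type of reduction of
`E` at `p`" (§1.2.1), through the printed ERL II′, in the Yan–Zhu / CGS product currency. A predicate;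
nothing asserted. [cite: YanZhu2024MainConjNonCM, Def. 3.11 with Thm. 3.9 (arXiv:2412.20078v4 TeX l.839–871) (shape; unit-root clause deleted, L-value through a continuation)]
[cite: CastellaGrossiSkinner2025, Thm. 2.4.1 (final TeX l.942–960) (the continuation binder, shape)]
[cite: BurungaleSkinnerTianWan2024, §1.2.1 (tex l.690–694) and Thm. 5.11 (l.4278–4291) (shape only; nothing asserted)] -/
def IsGreenbergLFunctionAnyRoot₂ (ι : PadicAlgCl p ≃+* ℂ) (v vbar : HeightOneSpectrum (𝓞 K))
    (κ₁ κ₂ : ZpExtension K p) (g₁ g₂ : absoluteGaloisGroup K) (f : CuspForm (Gamma0 N) 2)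
    (D : ℕ) [NeZero D] (hK : ℕ) (LK G : PowerSeries (PowerSeries (PadicComplexInt p))) : Prop :=
  ∀ (ξ : HeckeCharacter K) (r : FramedGaloisRep K (PadicAlgCl p) 1) (m n : ℕ) (α : ℂ),
    IsPAdicAvatarOf ι ξ r → FactorsThroughPair κ₁ κ₂ r →
    (∀ w : HeightOneSpectrum (𝓞 K), ξ.IsUnramifiedAt w) →
    ξ.HasInfinityType (fun _ ↦ -((m : ℤ) + 1)) (fun _ ↦ (n : ℤ) + 1) →
    α ^ 2 - cuspCoeff f p * α + p = 0 →
    ∀ θ : CuspForm (Gamma1 D) ((m + n + 3 : ℕ) : ℤ),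
      IsCMNewformOf (ξ / HeckeCharacter.normCharacter K ^ (m + 1)) θ →
    ∀ (L : ℂ → ℂ), Differentiable ℂ L →
      (∀ s : ℂ, (m : ℝ) + n + 3 < s.re → L s = rankinSelbergEulerProductHecke f ξ s) →
    ∀ y : ℂ_[p], IntSeries.HasValueAt₂ LK 0 (avatarValueAt r g₂ ^ 2 - 1) y →
      IntSeries.HasValueAt₂ G (avatarValueAt r g₁ - 1) (avatarValueAt r g₂ - 1)
        ((hK : ℂ_[p]) * y *
          ((ι.symm (typeTwoInterpolationValueL p N v vbar α ξ (-((n : ℤ) + 1)) ((m : ℤ) + 1)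
              (cmPeterssonNormSq θ) (L 1)) : PadicAlgCl p) : ℂ_[p]))

/-- Unfolding of the frame at one character of the range: the prescribed value of `G`.
[cite: YanZhu2024MainConjNonCM, Def. 3.11 with Thm. 3.9 (arXiv:2412.20078v4 TeX l.839–871)] -/
theorem IsGreenbergLFunctionAnyRoot₂.hasValueAt₂ {ι : PadicAlgCl p ≃+* ℂ}
    {v vbar : HeightOneSpectrum (𝓞 K)} {κ₁ κ₂ : ZpExtension K p} {g₁ g₂ : absoluteGaloisGroup K}
    {f : CuspForm (Gamma0 N) 2} {D : ℕ} [NeZero D] {hK : ℕ}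
    {LK G : PowerSeries (PowerSeries (PadicComplexInt p))}
    (h : IsGreenbergLFunctionAnyRoot₂ ι v vbar κ₁ κ₂ g₁ g₂ f D hK LK G)
    {ξ : HeckeCharacter K} {r : FramedGaloisRep K (PadicAlgCl p) 1} {m n : ℕ} {α : ℂ}
    (hr : IsPAdicAvatarOf ι ξ r) (hκ : FactorsThroughPair κ₁ κ₂ r)
    (hunr : ∀ w : HeightOneSpectrum (𝓞 K), ξ.IsUnramifiedAt w)
    (hinf : ξ.HasInfinityType (fun _ ↦ -((m : ℤ) + 1)) (fun _ ↦ (n : ℤ) + 1))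
    (hα : α ^ 2 - cuspCoeff f p * α + p = 0) {θ : CuspForm (Gamma1 D) ((m + n + 3 : ℕ) : ℤ)}
    (hθ : IsCMNewformOf (ξ / HeckeCharacter.normCharacter K ^ (m + 1)) θ)
    {L : ℂ → ℂ} (hL : Differentiable ℂ L)
    (hL' : ∀ s : ℂ, (m : ℝ) + n + 3 < s.re → L s = rankinSelbergEulerProductHecke f ξ s)
    {y : ℂ_[p]} (hy : IntSeries.HasValueAt₂ LK 0 (avatarValueAt r g₂ ^ 2 - 1) y) :
    IntSeries.HasValueAt₂ G (avatarValueAt r g₁ - 1) (avatarValueAt r g₂ - 1)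
      ((hK : ℂ_[p]) * y *
        ((ι.symm (typeTwoInterpolationValueL p N v vbar α ξ (-((n : ℤ) + 1)) ((m : ℤ) + 1)
            (cmPeterssonNormSq θ) (L 1)) : PadicAlgCl p) : ℂ_[p])) :=
  h ξ r m n α hr hκ hunr hinf hα θ hθ L hL hL' y hy

/-- **The prescribed value does not depend on the chosen root**: if `α` is a root then so is `p/α`,
and the frame's value at `p/α` equals the value at `α` (`typeTwoInterpolationValueL_div`) — the
algebraic reason the unit-root clause of the tree's ordinary frames only SELECTS a root.
[cite: YanZhu2024MainConjNonCM, Thm. 3.9 (𝓔(ξ,f,1), arXiv:2412.20078v4 TeX l.846–848)] -/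
theorem root_div_of_root {f : CuspForm (Gamma0 N) 2} {α : ℂ} (hα : α ^ 2 - cuspCoeff f p * α + p = 0) :
    ((p : ℂ) / α) ^ 2 - cuspCoeff f p * ((p : ℂ) / α) + p = 0 := by
  have hp : (p : ℂ) ≠ 0 := by exact_mod_cast (Fact.out : p.Prime).ne_zero
  have hα0 : α ≠ 0 := by
    rintro rfl
    apply hp
    simpa using hα
  have : ((p : ℂ) / α) ^ 2 - cuspCoeff f p * ((p : ℂ) / α) + p =
      ((p : ℂ) / α ^ 2) * (α ^ 2 - cuspCoeff f p * α + p) := by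
    field_simp
    ring
  rw [this, hα, mul_zero]

end TypeTwo

end Literature.NumberTheory.EllipticCurves

/-! ### The OPEN binders: Thm. 9.24 (GMC_r), semistable clause and twist clause -/

namespace Literature.NumberTheory.EllipticCurves.BurungaleSkinnerTianWan2024

open IwasawaAlgebra₂

/-- **OPEN HYPOTHESIS — UNREFEREED PREPRINT (arXiv:2409.01350v2), Thm. 9.24 (GMC_r, pp. 85–86), for an
elliptic curve: at ANY prime `p ∤ 2N` (ordinary or supersingular), for `N` square-free, `L` imaginary
quadratic with (ord), (irr_L) and (spl), the Greenberg `p`-adic `L`-function divides the characteristic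
ideal of the two-variable Greenberg Selmer group after inverting the non-zero elements of the cyclotomic
algebra.** Transcribed (module docstring): `W` globally minimal of conductor `N`, `Squarefree N`,
`p ≠ 2`, `p ∤ N`; `K` imaginary quadratic, `p` split with `v ≠ v̄` above `p`, `v` induced by `ι`; EXTRA
`(N, D_K) = 1` (§1.2.1 (h1)); (irr_L) as absolute irreducibility of every `𝔽_p`-framing of `E[p]|_{G_K}`;
(spl) as (∃ prime `q ∣ N` not split in `K`) ∧ (`2` splits in `K` ∨ `2 ∣ N`); `(κ₁, κ₂)` the cyclotomic /
anticyclotomic pair with generators `(γ₁, γ₂)`; for EVERY Katz frame `LK` with period data and EVERY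
`G` in the reduction-type-free Greenberg frame at the inverse generators, and every structure-compatible
`J`: some non-zero `s ∈ 𝒪_{ℂ_p}⟦T₁⟧` (cyclotomic variable only; WEAKER than the printed `Λ^{cyc,ur}`) has
`s · char(X_Gr)𝒪_{ℂ_p}⟦T₁,T₂⟧ ⊆ (G)`, `X_Gr = (W.baseChange K).XGr₂ p κ₁ κ₂ v̄ γ₁ γ₂`. READING FLAG
`BSTW-924-conjugate-convention`; PROVENANCE FLAG `bsd-ssimc` GAP(G2). NEVER cite this `Prop` as a theorem.
[claim: BurungaleSkinnerTianWan2024, status: under-review]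
[cite: BurungaleSkinnerTianWan2024, Thm. 9.24 first clause (pp. 85–86; label GMC_r, tex l.7258–7269) with (spl) (l.7263), 9.2 (GrL, l.6760) and §5.4 (l.4704) (ANNOUNCED, OPEN binder)] -/
def thm924_greenberg_dvd_charIdealXGr₂_awayFromCyc_OPEN : Prop :=
  ∀ {p : ℕ} [Fact p.Prime] (ι : PadicAlgCl p ≃+* ℂ) (W : WeierstrassCurve ℚ) [W.IsElliptic]
    [W.IsGloballyMinimal] (K : Type) [Field K] [NumberField K] (v vbar : HeightOneSpectrum (𝓞 K))
    (κ₁ κ₂ : ZpExtension K p) (γ₁ γ₂ : absoluteGaloisGroup K)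
    [Fact (ZpExtension.IsTopGeneratorPair κ₁ κ₂ γ₁ γ₂)] {N : ℕ} [NeZero N] {f : CuspForm (Gamma0 N) 2}
    (_ : IsNewformOf W f) [NeZero (NumberField.discr K).natAbs],
    -- `g = f_E` of level `N = N_E`, `N` square-free, `p ∤ 2N` (ANY reduction type at `p`)
    (N : ℤ) = W.conductorNorm ℤ → Squarefree N → p ≠ 2 → ¬ p ∣ N →
    -- `L = K` imaginary quadratic; (ord) `p = v v̄`, `v` induced by `ι`; EXTRA (h1) `(N, D_K) = 1`
    IsImaginaryQuadratic K → ((Ideal.span {(p : ℤ)}).primesOver (𝓞 K)).ncard = 2 →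
    ((p : ℕ) : 𝓞 K) ∈ v.asIdeal → ((p : ℕ) : 𝓞 K) ∈ vbar.asIdeal → vbar ≠ v →
    (∀ (w : InfinitePlace K) (k : 𝓞 K), k ∈ v.asIdeal ↔ ‖ι.symm (w.embedding (k : K))‖ < 1) →
    IsCoprime (N : ℤ) (NumberField.discr K) →
    -- (irr_L)
    (∀ ρ : ModPGaloisRep K (ZMod p) 2, (W.baseChange K).IsTorsionGaloisRep p ρ →
      FramedRep.IsAbsolutelyIrreducible ρ) →
    -- (spl): some prime `q ∣ N` does not split in `L`; and `2` splits in `L` or `2 ∣ N`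
    (∃ q : ℕ, q.Prime ∧ q ∣ N ∧ ((Ideal.span {(q : ℤ)}).primesOver (𝓞 K)).ncard ≠ 2) →
    (((Ideal.span {(2 : ℤ)}).primesOver (𝓞 K)).ncard = 2 ∨ 2 ∣ N) →
    -- the `ℤ_p²`-tower: `κ₁` cyclotomic, `κ₂` anticyclotomic (so `Λ^{cyc} = ofPlus ℤ_p⟦T₁⟧`)
    κ₁.IsCyclotomic → κ₂.IsAnticyclotomic →
    -- every Katz frame with period data and every (reduction-type-free) Greenberg frame `G`
    ∀ (Ω δ : ℂ) (Ωp : (unrIntegers p)ˣ) (LK G : PowerSeries (PowerSeries (PadicComplexInt p))),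
      Ω ≠ 0 → (δ ^ 2 = (NumberField.discr K : ℂ) ∨ δ ^ 2 = -(NumberField.discr K : ℂ)) →
      IsKatzMeasure₂ ι v vbar ∅ κ₁ κ₂ γ₁⁻¹ γ₂⁻¹ 1 Ω δ ((Ωp : unrIntegers p) : ℂ_[p]) LK →
      IsGreenbergLFunctionAnyRoot₂ ι v vbar κ₁ κ₂ γ₁⁻¹ γ₂⁻¹ f (NumberField.discr K).natAbs
        (NumberField.classNumber K) LK G →
    ∀ J : ℤ_[p] →+* PadicComplexInt p,
      (∀ x : ℤ_[p], ((J x : PadicComplexInt p) : ℂ_[p]) = ((x : ℚ_[p]) : ℂ_[p])) →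
    -- `𝓛_p^Gr ∣ ξ(X_Gr^ur)` after inverting the non-zero cyclotomic-variable elements
    ∃ s : PowerSeries (PadicComplexInt p), s ≠ 0 ∧
      Ideal.span {PowerSeries.map (PowerSeries.C (R := PadicComplexInt p)) s} *
          (WeierstrassCurve.XGr₂.charIdeal (W.baseChange K) p κ₁ κ₂ vbar γ₁ γ₂).map (toUnr₂ p J) ≤
        Ideal.span {G}

/-- **OPEN HYPOTHESIS — UNREFEREED PREPRINT (arXiv:2409.01350v2), Thm. 9.24, twist clause (p. 86):
"let `K` be a quadratic extension of `ℚ` with discriminant prime to `Np`, and `g_K := g ⊗ χ_K` … Then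
the divisibility also holds for `g_K`."** Transcribed: hypotheses on `(E, N, p, L)` as in the first
clause; `W'` a globally minimal model of `E^{(d)}` (`C • W' = W.quadraticTwist d`), `d ≠ 1` square-free,
every prime ramified in `ℚ(√d)` is `≠ p` and `∤ N` (`RamifiedInQuadratic`); `f'` the newform of `W'` at
its conductor `N'`; conclusion for `(W', f')`: `∃ s ∈ 𝒪_{ℂ_p}⟦T₁⟧ ∖ 0`,
`s · char(X_Gr(E^{(d)}/L_∞))𝒪_{ℂ_p}⟦T₁,T₂⟧ ⊆ (G')` for every reduction-type-free Greenberg frame `G'` of `f'`. PROVENANCE FLAG OPEN-QUESTIONS-01 Q17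
("essentially the same argument applies"). NEVER cite this `Prop` as a theorem.
[claim: BurungaleSkinnerTianWan2024, status: under-review]
[cite: BurungaleSkinnerTianWan2024, Thm. 9.24 last clause (p. 86; label GMC_r, tex l.7270–7273, proof l.7283–7287) (ANNOUNCED, OPEN binder)] -/
def thm924_twist_greenberg_dvd_charIdealXGr₂_awayFromCyc_OPEN : Prop :=
  ∀ {p : ℕ} [Fact p.Prime] (ι : PadicAlgCl p ≃+* ℂ) (W W' : WeierstrassCurve ℚ) [W.IsElliptic]
    [W.IsGloballyMinimal] [W'.IsElliptic] [W'.IsGloballyMinimal] (d : ℤ) (C : WeierstrassCurve.VariableChange ℚ)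
    (K : Type) [Field K] [NumberField K] (v vbar : HeightOneSpectrum (𝓞 K))
    (κ₁ κ₂ : ZpExtension K p) (γ₁ γ₂ : absoluteGaloisGroup K)
    [Fact (ZpExtension.IsTopGeneratorPair κ₁ κ₂ γ₁ γ₂)] {N N' : ℕ} [NeZero N] [NeZero N']
    {f' : CuspForm (Gamma0 N') 2} (_ : IsNewformOf W' f') [NeZero (NumberField.discr K).natAbs],
    -- `g = f_E`, `N = N_E` square-free, `p ∤ 2N`; `g_K = f_{E^{(d)}}` of level `N' = N_{E^{(d)}}`
    (N : ℤ) = W.conductorNorm ℤ → Squarefree N → p ≠ 2 → ¬ p ∣ N →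
    (N' : ℤ) = W'.conductorNorm ℤ →
    -- the twist: discriminant of `ℚ(√d)` prime to `Np`
    Squarefree d → d ≠ 1 → (∀ (q : ℕ) [Fact q.Prime], RamifiedInQuadratic d q → q ≠ p ∧ ¬ q ∣ N) →
    C • W' = W.quadraticTwist (d : ℚ) →
    -- `L = K`: (ord) with `v` induced by `ι`; EXTRA (h1)
    IsImaginaryQuadratic K → ((Ideal.span {(p : ℤ)}).primesOver (𝓞 K)).ncard = 2 →
    ((p : ℕ) : 𝓞 K) ∈ v.asIdeal → ((p : ℕ) : 𝓞 K) ∈ vbar.asIdeal → vbar ≠ v →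
    (∀ (w : InfinitePlace K) (k : 𝓞 K), k ∈ v.asIdeal ↔ ‖ι.symm (w.embedding (k : K))‖ < 1) →
    IsCoprime (N : ℤ) (NumberField.discr K) →
    -- (irr_L) for `E` (equivalently for `E^{(d)}`)
    (∀ ρ : ModPGaloisRep K (ZMod p) 2, (W.baseChange K).IsTorsionGaloisRep p ρ →
      FramedRep.IsAbsolutelyIrreducible ρ) →
    -- (spl)
    (∃ q : ℕ, q.Prime ∧ q ∣ N ∧ ((Ideal.span {(q : ℤ)}).primesOver (𝓞 K)).ncard ≠ 2) →
    (((Ideal.span {(2 : ℤ)}).primesOver (𝓞 K)).ncard = 2 ∨ 2 ∣ N) →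
    κ₁.IsCyclotomic → κ₂.IsAnticyclotomic →
    ∀ (Ω δ : ℂ) (Ωp : (unrIntegers p)ˣ) (LK G' : PowerSeries (PowerSeries (PadicComplexInt p))),
      Ω ≠ 0 → (δ ^ 2 = (NumberField.discr K : ℂ) ∨ δ ^ 2 = -(NumberField.discr K : ℂ)) →
      IsKatzMeasure₂ ι v vbar ∅ κ₁ κ₂ γ₁⁻¹ γ₂⁻¹ 1 Ω δ ((Ωp : unrIntegers p) : ℂ_[p]) LK →
      IsGreenbergLFunctionAnyRoot₂ ι v vbar κ₁ κ₂ γ₁⁻¹ γ₂⁻¹ f' (NumberField.discr K).natAbs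
        (NumberField.classNumber K) LK G' →
    ∀ J : ℤ_[p] →+* PadicComplexInt p,
      (∀ x : ℤ_[p], ((J x : PadicComplexInt p) : ℂ_[p]) = ((x : ℚ_[p]) : ℂ_[p])) →
    ∃ s : PowerSeries (PadicComplexInt p), s ≠ 0 ∧
      Ideal.span {PowerSeries.map (PowerSeries.C (R := PadicComplexInt p)) s} *
          (WeierstrassCurve.XGr₂.charIdeal (W'.baseChange K) p κ₁ κ₂ vbar γ₁ γ₂).map (toUnr₂ p J) ≤
        Ideal.span {G'}

/-! ### Bookkeeping: shapes shared with the tree's refereed Yan–Zhu statements -/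

/-- An inclusion `char(X_Gr)𝒪_{ℂ_p}⟦T₁,T₂⟧ ⊆ (G)` WITHOUT localisation (the shape delivered by the
refereed `YanZhu2026.thm42_XGr₂_isTorsion_charIdeal_le_greenberg` under the Heegner hypothesis) gives the
localised shape of Thm. 9.24 with the witness `s = 1`. Pure algebra; asserts nothing about curves.
[cite: YanZhu2024MainConjNonCM, Thm. 4.2 (2) and Cor. 4.6 (arXiv:2412.20078v4 TeX l.932–949, l.996–1003) (shape)] -/
theorem exists_cyc_mul_le_of_le {p : ℕ} [Fact p.Prime]
    {I : Ideal (PowerSeries (PowerSeries (PadicComplexInt p)))}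
    {G : PowerSeries (PowerSeries (PadicComplexInt p))} (h : I ≤ Ideal.span {G}) :
    ∃ s : PowerSeries (PadicComplexInt p), s ≠ 0 ∧
      Ideal.span {PowerSeries.map (PowerSeries.C (R := PadicComplexInt p)) s} * I ≤ Ideal.span {G} :=
  ⟨1, one_ne_zero, by simpa [map_one, Ideal.span_singleton_one, Ideal.top_mul] using h⟩

/-- A witness `s ∈ Λ^{cyc} = ℤ_p⟦T₁⟧` (Yan–Zhu's `ofPlus`, the currency of `IdealLeSpanAwayFromPlus`) read
along `J` IS a cyclotomic-variable witness of the shape used here: `toUnr₂ J (ofPlus s) = map C (map J s)`.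
[cite: YanZhu2024MainConjNonCM, Cor. 4.6 (S ⊂ Λ_K⁺, arXiv:2412.20078v4 TeX l.996–1003) (shape)] -/
theorem toUnr₂_ofPlus {p : ℕ} [Fact p.Prime] (J : ℤ_[p] →+* PadicComplexInt p) (s : IwasawaAlgebra p) :
    toUnr₂ p J (ofPlus p s) =
      PowerSeries.map (PowerSeries.C (R := PadicComplexInt p)) (PowerSeries.map J s) := by
  ext i j
  simp [toUnr₂, ofPlus, PowerSeries.coeff_map]

end Literature.NumberTheory.EllipticCurves.BurungaleSkinnerTianWan2024

end
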